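import Literature.Topology.PlanarFoliations.WalkWinding
import HarnessLib

/-!
# No open leaf spirals onto a null closed walk (straight piece in a reparametrised chart)

Topic: Topology / PlanarFoliations, sequel to `WalkWinding.lean`. The no-spiral theorem
`walk_no_spiral` is restated for a straight piece of the planar trace read in a reparametrisation
`e'` of a flow box `e` of the atlas with the same plaques (`walk_no_spiral'`, the interface of
`TraceStraight.exists_straightPiece`, exactly as `HugDegree.walkBase_not_null` restates the winding
argument), and turned into the statement used by the hugging argument for an open leaf: **if an
open leaf crosses the incoming star vertical of the first junction of a closed walk turning to
the side `s`, on that side, at heights accumulating to `0`, the base loop of the walk fence is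
not null-homotopic in its leaf** (`walkBase_not_null_leaf`).

## References

* C. Camacho, A. Lins Neto, *Geometric Theory of Foliations*, Birkhäuser (1985), Ch. VII §2
  [CamachoLinsNeto1985].
-/

noncomputable section

open Set Filter Function Metric unitInterval
open _root_.Topology
open Literature.Topology.FourManifolds Literature.Topology.FourManifolds.Foliation Literature.Topology.PlaneTopology

namespace Literature.Topology.PlanarFoliations

variable {X : Type*} [TopologicalSpace X] [T2Space X] [SecondCountableTopology X] [Nonempty X] {F : Foliation ℝ X} {ι : X → ℂ}
variable {B : Type*} [NormedAddCommGroup B] [NormedSpace ℝ B] [LocallyConnectedSpace B] [Nonempty B] {M : Type*} [TopologicalSpace M]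
  {T : Foliation B M} {g : ℂ → M}

namespace StarData

variable {D : StarData F ι T g} {hι : IsOpenEmbedding ι}
variable (ho : F.IsTransverselyOriented) {J : ℕ → D.WalkJunction hι}
  {ℓ : ∀ k, Path (J k).Kout.base (J (k + 1)).Kin.base} (hℓ : ∀ k, Continuous (toLeafSpace ∘ ℓ k : I → F.LeafSpace))
  {s : ℝ} (hs : s = 1 ∨ s = -1) (hturn : ∀ k, (J k).jout = (J k).turn s)

/-! ## No open leaf spirals onto a null closed walk -/

include ho hℓ hs hturn in
/-- **No open leaf meets the start transversal of a null closed walk with a straight piece at side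
levels close to the base level** — the form of `walk_no_spiral` for a straight piece read in a
reparametrisation `e'` (any chart of `X` with target the plane) of a flow box `e` of the atlas
with the same plaques, the test points being plaque points of `e` (the output of
`TraceStraight.exists_straightPiece`). [cite: CamachoLinsNeto1985, Ch. VII §2] -/
theorem walk_no_spiral' (hbi : IsBiOriented F) {m : ℕ} (hper : J m = J 0) {e : OpenPartialHomeomorph X (ℝ × ℝ)}
    (he : e ∈ F.atlas) {e' : OpenPartialHomeomorph X (ℝ × ℝ)} (he' : e'.target = univ) (P : StraightPiece ι e' (traceLoop J ℓ m))
    {a : ℝ} (hP : ∀ ρ, P.pt ρ = ι (e.symm (a, P.h₀ + ρ)))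
    (hnull : ∃ (p : T.LeafSpace) (L : Path p p), (∀ θ, L θ = toLeafSpace (D.walkBase J ℓ m θ)) ∧ L.Homotopic (Path.refl p))
    {y₀ : X} (hL : ¬ IsCompact (F.leaf y₀)) :
    ∃ η > (0 : ℝ), ∀ τ ∈ Ioo ((J 0).τ₀ - η) ((J 0).τ₀ + η), 0 < s * (τ - (J 0).τ₀) →
      (J 0).Kin.T₁ (J 0).χ₀ τ ∉ F.leaf y₀ := by
  set W := D.walkFence ho hℓ hs hturn m with hW
  set Ψ := walkPlaneBand ho hℓ hs hturn m with hΨ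
  set ω := walkPlaneBase J ℓ m with hω
  -- generic test heights off the leaf `L`
  obtain ⟨ρ, hρ, hρp, hρm⟩ := exists_heights_not_mem_leafHeights (F := F) he y₀ P.h₀ P.hr
  have hp : ∀ lv : ℝ, lv = ρ ∨ lv = -ρ → ∀ z ∈ F.leaf y₀, ι z ≠ P.pt lv := by
    rintro lv (rfl | rfl)
    · rw [hP]; exact image_ne_of_not_mem_leafHeights he hρp hι.injective
    · rw [hP, ← sub_eq_add_neg]; exact image_ne_of_not_mem_leafHeights he hρm hι.injective
  -- the test points are off the trace, with a margin
  have hωc : Continuous ω := continuous_walkPlaneBase ho hℓ hs hturn m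
  have hne : ∀ lv : ℝ, lv = ρ ∨ lv = -ρ → ∀ θ : I, ω θ ≠ P.pt lv := fun lv hlv θ ↦ by
    rw [hω, ← traceLoop_coe hper θ]
    refine P.ne_pt hι.injective he' (periodic_traceLoop m) ?_ ?_ θ
    · rcases hlv with rfl | rfl <;> [exact hρ.1.ne'; exact neg_ne_zero.2 hρ.1.ne']
    · rcases hlv with rfl | rfl <;> simp [abs_of_pos hρ.1, hρ.2]
  have hKc : IsCompact (range ω) := isCompact_range hωc
  have hdpos : ∀ lv : ℝ, lv = ρ ∨ lv = -ρ → 0 < infDist (P.pt lv) (range ω) := fun lv hlv ↦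
    (hKc.isClosed.notMem_iff_infDist_pos (range_nonempty ω)).1 (by rintro ⟨θ, hθ⟩; exact hne lv hlv θ hθ)
  set d := min (infDist (P.pt ρ) (range ω)) (infDist (P.pt (-ρ)) (range ω)) with hd
  have hd0 : 0 < d := lt_min (hdpos ρ (Or.inl rfl)) (hdpos (-ρ) (Or.inr rfl))
  have hfar : ∀ lv : ℝ, lv = ρ ∨ lv = -ρ → ∀ {z : ℂ} {θ : I}, dist z (ω θ) < d → z ≠ P.pt lv := by
    intro lv hlv z θ hz heq
    rw [heq] at hz
    have h1 : d ≤ infDist (P.pt lv) (range ω) := by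
      rcases hlv with rfl | rfl <;> [exact min_le_left _ _; exact min_le_right _ _]
    have h2 : infDist (P.pt lv) (range ω) ≤ dist (P.pt lv) (ω θ) := infDist_le_dist_of_mem ⟨θ, rfl⟩
    linarith
  -- uniform convergence of the band, and the return of the levels
  obtain ⟨η₁, hη₁, hη₁ε, hχ⟩ := walkFence_χ_eq_χ₀_of_null ho J ℓ hℓ hs hturn hper hnull
  obtain ⟨η₂, hη₂, hη₂sub⟩ := Metric.eventually_nhds_iff.1 (eventually_forall_dist_lt ho hℓ hs hturn m hd0)
  refine ⟨min η₁ η₂, lt_min hη₁ hη₂, fun τ hτ hsτ hyτ ↦ ?_⟩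
  have hτ₁ : τ ∈ Ioo ((J 0).τ₀ - η₁) ((J 0).τ₀ + η₁) :=
    ⟨by linarith [hτ.1, min_le_left η₁ η₂], by linarith [hτ.2, min_le_left η₁ η₂]⟩
  have hτW : τ ∈ Ioo ((J 0).τ₀ - W.ε) ((J 0).τ₀ + W.ε) := ⟨by linarith [hτ₁.1], by linarith [hτ₁.2]⟩
  have hτS : τ ∈ sideLevels (J 0).τ₀ s W.ε := ⟨hτW, hsτ.le⟩
  -- the levels between `τ₀` and `τ`
  have hbetween : ∀ u ∈ Icc (0 : ℝ) 1, (J 0).τ₀ + u * (τ - (J 0).τ₀) ∈ Ioo ((J 0).τ₀ - min η₁ η₂) ((J 0).τ₀ + min η₁ η₂) := by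
    intro u hu
    have h1 : |u * (τ - (J 0).τ₀)| ≤ |τ - (J 0).τ₀| := by
      rw [abs_mul, abs_of_nonneg hu.1]; exact mul_le_of_le_one_left (abs_nonneg _) hu.2
    have h2 : |τ - (J 0).τ₀| < min η₁ η₂ := abs_sub_lt_iff.2 ⟨by linarith [hτ.2], by linarith [hτ.1]⟩
    constructor <;> [linarith [neg_abs_le (u * (τ - (J 0).τ₀))]; linarith [le_abs_self (u * (τ - (J 0).τ₀))]]
  have hclosed : ∀ u ∈ Icc (0 : ℝ) 1, Ψ 0 ((J 0).τ₀ + u * (τ - (J 0).τ₀)) = Ψ 1 ((J 0).τ₀ + u * (τ - (J 0).τ₀)) := by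
    intro u hu
    set lv := (J 0).τ₀ + u * (τ - (J 0).τ₀) with hlv
    have hlv₁ : lv ∈ Ioo ((J 0).τ₀ - η₁) ((J 0).τ₀ + η₁) :=
      ⟨by linarith [(hbetween u hu).1, min_le_left η₁ η₂], by linarith [(hbetween u hu).2, min_le_left η₁ η₂]⟩
    have hlvW : lv ∈ Ioo ((J 0).τ₀ - W.ε) ((J 0).τ₀ + W.ε) := ⟨by linarith [hlv₁.1], by linarith [hlv₁.2]⟩
    obtain ⟨h0, h1⟩ := walkPlaneBand_ends ho hℓ hs hturn m hlvW
    rw [hΨ, h0, h1, hχ lv hlv₁]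
    have : (D.star (J m).v (J m).hv).pt (J m).jin ((J m).β, (J 0).χ₀ lv) = (D.star (J 0).v (J 0).hv).pt (J 0).jin ((J 0).β, (J 0).χ₀ lv) := by
      rw [hper]
    exact this.symm
  have havoid : ∀ sg : ℝ, sg = ρ ∨ sg = -ρ → ∀ u ∈ Icc (0 : ℝ) 1, ∀ θ, Ψ θ ((J 0).τ₀ + u * (τ - (J 0).τ₀)) ≠ P.pt sg := by
    intro sg hsg u hu θ
    have hlvS : (J 0).τ₀ + u * (τ - (J 0).τ₀) ∈ sideLevels (J 0).τ₀ s W.ε := mem_sideLevels_of_between hτS hu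
    have hlv₂ : dist ((J 0).τ₀ + u * (τ - (J 0).τ₀)) (J 0).τ₀ < η₂ := by
      rw [Real.dist_eq]
      have := hbetween u hu
      exact abs_sub_lt_iff.2 ⟨by linarith [this.2, min_le_right η₁ η₂], by linarith [this.1, min_le_right η₁ η₂]⟩
    exact hfar sg hsg (hη₂sub hlv₂ hlvS θ)
  -- the band loop at `τ` winds like the trace about `p±` ...
  have hwindeq : ∀ sg : ℝ, sg = ρ ∨ sg = -ρ →
      wind (fun t ↦ Ψ (projIcc 0 1 zero_le_one t) τ - P.pt sg) = wind (fun t ↦ traceLoop J ℓ m t - P.pt sg) := by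
    intro sg hsg
    rw [hΨ, wind_walkPlaneBand_eq ho hℓ hs hturn m hτS hclosed (havoid sg hsg)]
    exact wind_congr fun t ht ↦ by rw [traceLoop_apply_of_mem hper ht]
  -- ... and winds `0`, being the image of a loop of the open leaf `L`
  obtain ⟨hΦΨ, hΨc, hΨ0, hΨ1, -, -⟩ := W.track τ hτW hsτ
  have hχτ : W.χ τ = (J 0).χ₀ τ := hχ τ hτ₁
  have hc1 : W.Ψ 1 τ = W.Ψ 0 τ := by
    rw [hΨ1, hΨ0]
    have : (J m).Kin.T₁ W.χ τ = (J 0).Kin.T₁ W.χ τ := by rw [hper]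
    rw [this]
    simp only [ProngBox.T₁, hχτ]
  have hc0 : W.Ψ 0 τ ∈ F.leaf y₀ := by rw [hΨ0]; exact hyτ
  have hwind0 : ∀ sg : ℝ, sg = ρ ∨ sg = -ρ → wind (fun t ↦ Ψ (projIcc 0 1 zero_le_one t) τ - P.pt sg) = 0 := by
    intro sg hsg
    have h := wind_eq_zero_of_loop_in_open_leaf hbi hι.continuous hL hΨc hc0 hc1 (hp sg hsg)
    have heq : (fun t ↦ ι (W.Ψ (projIcc 0 1 zero_le_one t) τ) - P.pt sg) = fun t ↦ Ψ (projIcc 0 1 zero_le_one t) τ - P.pt sg := by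
      funext t
      rw [hΨ, walkPlaneBand_eq_ι ho hℓ hs hturn m hτW hsτ]
    rw [heq] at h
    exact h
  -- contradiction with the jump of the winding numbers of the trace across the straight piece
  have hjump := P.wind_sub_wind hι he' (continuous_traceLoop ho hℓ hs hturn hper) (periodic_traceLoop m) hρ
  rw [← hwindeq (-ρ) (Or.inr rfl), ← hwindeq ρ (Or.inl rfl), hwind0 ρ (Or.inl rfl), hwind0 (-ρ) (Or.inr rfl)] at hjump
  norm_num at hjump


include ho hℓ hs hturn in
/-- **The base loop of a closed walk hugged on its turning side by an open leaf is essential**: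
if an open leaf crosses the incoming star vertical of the first junction on the side `s` at
heights accumulating to `0`, and the planar trace of the walk has a straight piece as in
`walk_no_spiral'`, the base loop of the walk fence is not null-homotopic in its leaf of `T`.
[cite: CamachoLinsNeto1985, Ch. VII §2] -/
theorem walkBase_not_null_leaf (hbi : IsBiOriented F) {m : ℕ} (hper : J m = J 0) {e : OpenPartialHomeomorph X (ℝ × ℝ)}
    (he : e ∈ F.atlas) {e' : OpenPartialHomeomorph X (ℝ × ℝ)} (he' : e'.target = univ) (P : StraightPiece ι e' (traceLoop J ℓ m))
    {a : ℝ} (hP : ∀ ρ, P.pt ρ = ι (e.symm (a, P.h₀ + ρ)))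
    {y₀ : X} (hL : ¬ IsCompact (F.leaf y₀))
    (hcross : ∀ ε > 0, ∃ h, 0 < s * h ∧ |h| < ε ∧ (D.star _ (J 0).hv).horiz hι (J 0).jin h (J 0).β ∈ F.leaf y₀) :
    ¬ ∃ (p : T.LeafSpace) (L : Path p p), (∀ θ, L θ = toLeafSpace (D.walkBase J ℓ m θ)) ∧ L.Homotopic (Path.refl p) := by
  intro hnull
  obtain ⟨η, hη, hfree⟩ := walk_no_spiral' ho hℓ hs hturn hbi hper he he' P hP hnull hL
  -- a crossing height whose level is within `η`
  have hsymm0 : (J 0).χ₀.symm 0 = (J 0).τ₀ := by rw [← (J 0).χ₀_τ₀, OrderIso.symm_apply_apply]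
  have h₃ : ∀ᶠ h in 𝓝 (0 : ℝ), dist ((J 0).χ₀.symm h) (J 0).τ₀ < η := by
    have hc : ContinuousAt (J 0).χ₀.symm 0 := (J 0).χ₀.symm.continuous.continuousAt
    have := hc.preimage_mem_nhds (ball_mem_nhds ((J 0).χ₀.symm 0) hη)
    rw [hsymm0] at this
    exact this
  obtain ⟨ε₀, hε₀, hε₀sub⟩ := Metric.eventually_nhds_iff.1 h₃
  obtain ⟨h, hsh, hhε, hmem⟩ := hcross ε₀ hε₀
  set τ := (J 0).χ₀.symm h with hτdef
  have hχτ : (J 0).χ₀ τ = h := (J 0).χ₀.apply_symm_apply h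
  have hτclose : dist τ (J 0).τ₀ < η := hε₀sub (by rw [dist_zero_right]; exact hhε)
  have hτ : τ ∈ Ioo ((J 0).τ₀ - η) ((J 0).τ₀ + η) := by
    rw [Real.dist_eq, abs_lt] at hτclose; constructor <;> linarith [hτclose.1, hτclose.2]
  have hsτ : 0 < s * (τ - (J 0).τ₀) := by
    rcases hs with rfl | rfl
    · have hh : 0 < h := by linarith
      have : (J 0).χ₀.symm 0 < (J 0).χ₀.symm h := (J 0).χ₀.symm.strictMono hh
      rw [hsymm0] at this; linarith
    · have hh : h < 0 := by linarith
      have : (J 0).χ₀.symm h < (J 0).χ₀.symm 0 := (J 0).χ₀.symm.strictMono hh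
      rw [hsymm0] at this; linarith
  refine hfree τ hτ hsτ ?_
  show (D.star _ (J 0).hv).horiz hι (J 0).jin ((J 0).χ₀ τ) (J 0).β ∈ F.leaf y₀
  rw [hχτ]
  exact hmem

end StarData

end Literature.Topology.PlanarFoliations
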